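import Mathlib
import Literature.Computability.AlgebraicComplexity.PermanentIrreducible
import Literature.Computability.AlgebraicComplexity.ValiantClasses

/-!
# Redirect of crux `SliceSignRank.PositiveSliceNormalForm` (stmt-ValiantsHypothesis-15119): CYCLE-FREE split glue

Companion of `Theorems/SliceSignRankPositiveSliceNormalFormSplit.lean` (same assembly, proved there against the
route declarations).  This file restates the assembly with ALL THREE statements inlined — the two split
children `SrkNotQP` (SRK∞) and `PositiveSliceSignTransfer` (SGN-TRANSFER) as hypotheses and the parent crux
FNF⁺ = `PositiveSliceNormalForm` as conclusion — and imports only the Literature modules the route file already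
imports, so that the gate can render
`theorem PositiveSliceNormalFormGlueBy_holds : SrkNotQP → PositiveSliceSignTransfer → PositiveSliceNormalForm :=
_root_.….positiveSliceNormalForm_of_subs` INSIDE `Theses/SliceSignRank.lean` without an import cycle (the three
route `def`s unfold to the types below definitionally).

Content (trivial seam): SRK∞ says that for every `c` some `n ≥ 1` admits no real sign-representation of `sgn` on
`S_n` of length `≤ 2^((log₂ n + c)^c)`; SGN-TRANSFER says every positive-slice `VP` family has such
representations for all `n ≥ 1` with one `c`; so no positive-slice family is in `VP` (PPC) and FNF⁺ holds
vacuously in its `IsVPFamily` hypothesis.  Pure logic; no named facts.  References for the notions: Valiant,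
STOC 1979; Forster, JCSS 65 (2002); Razborov–Sherstov, SIAM J. Comput. 39 (2010); Alon–Moran–Yehudayoff, COLT 2016.
-/

-- single-conjunct layout: Sub = Summit, duplicated namespace component intended
set_option linter.dupNamespace false

namespace Summit.ValiantsHypothesis.ValiantsHypothesis.Theorems.SliceSignRankPositiveSliceNormalFormSplitGlue

open Literature.Computability.AlgebraicComplexity
open scoped BigOperators

/-- **SPLIT ASSEMBLY, cycle-free form**: `SrkNotQP → PositiveSliceSignTransfer → PositiveSliceNormalForm` with the
three route statements inlined verbatim (for `ledger route edit … --split PositiveSliceNormalForm --glue-by`).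
[folklore] -/
theorem positiveSliceNormalForm_of_subs
    (hS : ∀ c : ℕ, ∃ n : ℕ, 1 ≤ n ∧ ∀ k ≤ 2 ^ ((Nat.log 2 n + c) ^ c),
      ¬ ∃ W : Fin k → Matrix (Fin n) (Fin n) ℝ, ∀ σ : Equiv.Perm (Fin n),
        0 < ((Equiv.Perm.sign σ : ℤ) : ℝ) * ∑ t, ∏ i, W t (σ i) i)
    (hT : ∀ f : (n : ℕ) → MvPolynomial (Fin n × Fin n) ℂ,
      (∀ (n : ℕ) (d : Fin n × Fin n →₀ ℕ), (∀ ρ : Equiv.Perm (Fin n), permMonomial ρ ≠ d) →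
          MvPolynomial.coeff d (f n) = 0) →
      (∀ (n : ℕ) (ρ : Equiv.Perm (Fin n)), ∃ r : ℝ, 0 < r ∧
          MvPolynomial.coeff (permMonomial ρ) (f n) = (r : ℂ)) →
      IsVPFamily f →
      ∃ c : ℕ, ∀ n : ℕ, 1 ≤ n → ∃ k ≤ 2 ^ ((Nat.log 2 n + c) ^ c),
        ∃ W : Fin k → Matrix (Fin n) (Fin n) ℝ, ∀ σ : Equiv.Perm (Fin n),
          0 < ((Equiv.Perm.sign σ : ℤ) : ℝ) * ∑ t, ∏ i, W t (σ i) i) :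
    ∀ f : (n : ℕ) → MvPolynomial (Fin n × Fin n) ℂ,
      (∀ (n : ℕ) (d : Fin n × Fin n →₀ ℕ), (∀ ρ : Equiv.Perm (Fin n), permMonomial ρ ≠ d) →
          MvPolynomial.coeff d (f n) = 0) →
      (∀ (n : ℕ) (ρ : Equiv.Perm (Fin n)), ∃ r : ℝ, 0 < r ∧
          MvPolynomial.coeff (permMonomial ρ) (f n) = (r : ℂ)) →
      IsVPFamily f →
      ∃ c : ℕ, ∀ n : ℕ, 1 ≤ n → ∃ k ≤ 2 ^ ((Nat.log 2 n + c) ^ c),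
        ∃ W : Fin k → Matrix (Fin n) (Fin n) ℝ, ∀ σ : Equiv.Perm (Fin n),
          MvPolynomial.coeff (permMonomial σ) (f n) =
            ((Equiv.Perm.sign σ : ℤ) : ℂ) * ∑ t, ∏ i, ((W t (σ i) i : ℝ) : ℂ) := by
  intro f h0 h1 hVP
  exfalso
  obtain ⟨c, hc⟩ := hT f h0 h1 hVP
  obtain ⟨n, hn1, hn⟩ := hS c
  obtain ⟨k, hk, W, hW⟩ := hc n hn1
  exact hn k hk ⟨W, hW⟩

end Summit.ValiantsHypothesis.ValiantsHypothesis.Theorems.SliceSignRankPositiveSliceNormalFormSplitGlue
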